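import Literature.Probability.RandomPlanarGeometry.HexSAWStripBridgeLengthRenewal
import HarnessLib

/-!
# The critical strip bridges in the LENGTH fugacity: the residue `(1 − s) · D_T(s)_{ab} → ρ′ u′_a ℓ′_b` and the exact Cesàro law
# `(1/N) Σ_{n<N} D(n)_{ab} → ρ′ u′_a ℓ′_b` (module «LENGTH-NEUMANN»)

Topic `Literature/Probability/RandomPlanarGeometry` (continues «BRIDGE-LENGTH-RENEWAL» `HexSAWStripBridgeLengthRenewal.lean` — the exact
renewal equation in length `HV.LUM_ren`, truncation independence, `HV.summable_LUM_LMM_mul_pow`, `HV.partialSum_LUM_linear` —,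
«BRIDGE-LENGTH-LINEAR» / «LENGTH-POINTWISE» (the two-sided linear law in length and the pointwise bound), `HexSAWStripBridgeRenewal.lean`
(`HV.Imat`, `HV.reach_Imat_all`: irreducibility of the truncated kernel at `y = 1`), and the tree's abstract R-theory
`Literature/Analysis/Matrix/NonnegMatrixFamilyResidue.lean` (`NeumannFamily`, `exists_pos_mul_neumannSum_le`,
`NeumannFamily.exists_tendsto_mul_neumannSum_apply`) with Hardy–Littlewood `Literature/Analysis/Asymptotics/KaramataPowerSeries.lean`).
Lane «pcv-sawmu» (CriticalPhenomena venture), a-p2 g21 — the LENGTH chapter (x-variable) announced in HANDOFF a-p2 g19 (B).  Sources of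
the SETTING: H. Duminil-Copin, A. Hammond, CMP 324 (2013) §2.2 (bridges, irreducible bridges, renewal); E. Seneta, Non-negative Matrices
(1973) Chapter 6 (R-theory); W. Feller, vol. II (1971) XIII.5 (Hardy–Littlewood–Karamata); N. R. Beaton, M. Bousquet-Mélou, J. de Gier,
H. Duminil-Copin, A. J. Guttmann, CMP 326 (2014) Corollary 8 (arXiv:1109.0358v5 p. 12: `ρ_T(y_T) = x_c` — the `x`-radius of the strip
series at `y = y_T` is `x_c`).  The print gives the RADIUS only; the residue and the Cesàro law below are the lane's (no transfer matrix,
no rationality, no Perron–Frobenius).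

## What is proved (namespace `Literature.Probability.RandomPlanarGeometry.SAW.HV`; `y_T = stripYT T`; `D(n) = LUM T n n y_T`, `M(n) = LMM T n n y_T`)

* §1 `stripLenI T s` (`I_T(s)_{ab} = Σ_n M(n)_{ab} s^n`), `stripLenD T s` (`D_T(s)_{ab} = Σ_n D(n)_{ab} s^n`) for `0 ≤ s < 1` (substitute
  `s = x/x_c`: the irreducible / all-bridges generating functions of `S_T` in the LENGTH fugacity `x < x_c` at surface fugacity `y_T`);
  `lenSlices_basic`, `stripLenI_nonneg_le_stripLenD`; ★★ `stripLenD_eq_stripLenI_add_mul` — `D_T(s) = I_T(s) + I_T(s)·D_T(s)` (Cauchy products over `LUM_ren`).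
* §2 `sum_range_pow_stripLenI_le`, ★ `summable_pow_stripLenI`, ★★ `neumannSum_stripLenI_eq` — `Σ_k I_T(s)^k = 1 + D_T(s)` on `[0,1)`.
* §3 `Imat_eq_sum_LMs`, ★ `pow_mul_Imat_one_le_stripLenI` (`I_T(s) ≥ s^N I_N(1)`), ★★ `stripLenI_irred` — `I_T(s)` is irreducible for `0 < s < 1`.
* §4 `stripLenI_mono`, `stripLenI_convexOn` (power series with non-negative coefficients).
* §5 ★ `exists_neumannSum_stripLenI_le` (`≤ (1+K)/(1−s)`), ★ `exists_le_sum_stripLenD` (`Σ_{ab} D_T(s)_{ab} ≥ c s/(1−s) − C`, Abel summation over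
  «BRIDGE-LENGTH-LINEAR»).
* §6 ★★ `exists_neumannFamily_stripLenI` — `s ↦ I_T(s)` is a `NeumannFamily` on a left neighbourhood of `1` (`T ≥ 2`; lower bound spread to every
  entry by irreducibility); ★★★ `exists_tendsto_stripLenD_residue` — THE RESIDUE IN THE LENGTH FUGACITY: positive `u′`, `ℓ′`, `ρ′` with
  `(1 − s) · D_T(s)_{ab} ⟶ ρ′ · u′_a ℓ′_b` as `s ↑ 1`, all levels `a, b` (rank one) — the `x ↑ x_c` twin at `y = y_T` of the tree's
  `exists_tendsto_hKernel_residue` (`y ↑ y_T` at `x = x_c`).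
* §7 ★★★ `exists_tendsto_cesaro_LUM` — THE EXACT CESÀRO LAW IN LENGTH: `(1/N) Σ_{n<N} D(n)_{ab} ⟶ ρ′ u′_a ℓ′_b` (`T ≥ 2`), i.e. the
  `x_c^n y_T^{#top}`-weight of the critical bridges `a → b` with `n` steps has Cesàro mean converging to an explicit positive rank-one
  constant (Hardy–Littlewood's Tauberian theorem on §6).
* §8 ★★★ `summable_length_mul_LMM` — `Σ_n n · M(n)_{ab} < ∞`: the critical irreducible bridges have FINITE MEAN LENGTH at `y_T` (the family
  `s ↦ I_T(s)` is Lipschitz at `s = 1` by the R-theory bound `Ilim − I_T(s) ≤ (C/c²)(1 − s)`) — the `mean` input of the matrix renewal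
  theorem in the length variable; only the period-two bookkeeping now separates the lane from a POINTWISE law in length.
* §9 ★★ `summable_LMM_stripYT` — `Σ_n M(n)_{ab} < ∞` AT `y = y_T`: the full irreducible kernel `I_T(x_c; y_T)` is entrywise finite at the
  convergence parameter; `Imat_eq_sum_range_LMM` (`I_N = Σ_{n≤N} M(n)`), ★ `tendsto_Imat_stripYT` — `I_N(y_T) ↑ Σ_n M(n)`.

Label: LANE THEOREM (own result of lane «pcv-sawmu», a-p2 g21, 2026-08-26).  NOT claimed: the pointwise limit of `D(n)_{ab}` (lengths
between fixed levels have fixed parity — period two; needs a period-two matrix renewal theorem), the corresponding statements for the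
β-walks / chains by length, uniformity in `T`, rates.
-/

noncomputable section

open Finset Filter Topology Matrix Literature.Probability.LatticeModels Literature.Probability.Percolation Literature.Analysis.Matrix

namespace Literature.Probability.RandomPlanarGeometry.SAW

namespace HV

variable {T : ℕ}

/-! ### §1 The length generating functions of the critical bridges: `I_T(s)` (irreducible) and `D_T(s)` (all), `0 ≤ s < 1` -/

/-- ★ **The irreducible-bridge kernel in the LENGTH fugacity** at the threshold: `I_T(s)_{ab} = Σ_n M(n)_{ab} s^n`, `M(n)_{ab}` the
weight `x_c^n y_T^{#top}` of the irreducible standard horizontal bridges `a → b` of `S_T` with exactly `n` steps (`= LMM T n n y_T a b`).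
Substituting `s = x/x_c`: the irreducible kernel at length fugacity `x < x_c` and surface fugacity `y_T`.
[cite: DuminilCopinHammond2013, §2.2 (irreducible bridges); BeatonBousquetMelouDeGierDuminilCopinGuttmann2014, Corollary 8 (arXiv v5 p. 12: ρ_T(y_T) = x_c); lane «pcv-sawmu» a-p2 g21] -/
def stripLenI (T : ℕ) (s : ℝ) : Matrix (Fin (2 * T)) (Fin (2 * T)) ℝ :=
  fun a b => ∑' n : ℕ, LMM T n (n : ℤ) (stripYT T) a b * s ^ n

/-- ★ **The all-bridges series in the LENGTH fugacity** at the threshold: `D_T(s)_{ab} = Σ_n D(n)_{ab} s^n` (`D(n) = LUM T n n y_T`).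
[cite: DuminilCopinHammond2013, §2.2; BeatonBousquetMelouDeGierDuminilCopinGuttmann2014, Corollary 8; lane «pcv-sawmu» a-p2 g21] -/
def stripLenD (T : ℕ) (s : ℝ) : Matrix (Fin (2 * T)) (Fin (2 * T)) ℝ :=
  fun a b => ∑' n : ℕ, LUM T n (n : ℤ) (stripYT T) a b * s ^ n

section Series

variable {s : ℝ}

/-- Non-negativity, boundedness and summability of the slices (plumbing over «LENGTH-POINTWISE» / «BRIDGE-LENGTH-RENEWAL»).
[cite: DuminilCopinHammond2013, §2.2; lane plumbing] -/
theorem lenSlices_basic (hT : 1 ≤ T) (a b : Fin (2 * T)) (hs0 : 0 ≤ s) (hs1 : s < 1) :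
    (∀ n : ℕ, 0 ≤ LMM T n (n : ℤ) (stripYT T) a b ∧ 0 ≤ LUM T n (n : ℤ) (stripYT T) a b ∧
        LMM T n (n : ℤ) (stripYT T) a b ≤ LUM T n (n : ℤ) (stripYT T) a b) ∧
      Summable (fun n : ℕ => LUM T n (n : ℤ) (stripYT T) a b * s ^ n) ∧
      Summable (fun n : ℕ => LMM T n (n : ℤ) (stripYT T) a b * s ^ n) := by
  have hy := (stripYT_pos hT).le
  obtain ⟨-, hD, hM⟩ := summable_LUM_LMM_mul_pow hT a b hs0 hs1
  exact ⟨fun n => ⟨(LMM_LUM_nonneg hy _ a b).1, (LMM_LUM_nonneg hy _ a b).2, LMM_le_LUM_self hy n a b⟩, hD, hM⟩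

/-- `0 ≤ I_T(s)_{ab} ≤ D_T(s)_{ab}` for `0 ≤ s < 1`. [cite: DuminilCopinHammond2013, §2.2; lane plumbing] -/
theorem stripLenI_nonneg_le_stripLenD (hT : 1 ≤ T) (hs0 : 0 ≤ s) (hs1 : s < 1) (a b : Fin (2 * T)) :
    0 ≤ stripLenI T s a b ∧ stripLenI T s a b ≤ stripLenD T s a b ∧ 0 ≤ stripLenD T s a b := by
  obtain ⟨h0, hD, hM⟩ := lenSlices_basic hT a b hs0 hs1
  refine ⟨tsum_nonneg fun n => mul_nonneg (h0 n).1 (pow_nonneg hs0 _),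
    hM.tsum_le_tsum (fun n => mul_le_mul_of_nonneg_right (h0 n).2.2 (pow_nonneg hs0 _)) hD,
    tsum_nonneg fun n => mul_nonneg (h0 n).2.1 (pow_nonneg hs0 _)⟩

/-- Cauchy product with powers for non-negative summable data (plumbing; Mathlib `Summable.tsum_mul_tsum_eq_tsum_sum_antidiagonal`).
[cite: Feller1968, XIII.3; lane plumbing] (Kept `private`: a statement-twin is private in `Process/MatrixRenewalCoefficients.lean`.) -/
private theorem tsum_antidiagonal_mul_pow' {f g : ℕ → ℝ} (hf : ∀ m, 0 ≤ f m) (hg : ∀ m, 0 ≤ g m) {s : ℝ} (hs : 0 ≤ s)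
    (hfs : Summable fun m => f m * s ^ m) (hgs : Summable fun m => g m * s ^ m) :
    (Summable fun m => (∑ p ∈ antidiagonal m, f p.1 * g p.2) * s ^ m) ∧
      ∑' m, (∑ p ∈ antidiagonal m, f p.1 * g p.2) * s ^ m = (∑' m, f m * s ^ m) * ∑' m, g m * s ^ m := by
  have hfg : Summable fun x : ℕ × ℕ => (fun m => f m * s ^ m) x.1 * (fun m => g m * s ^ m) x.2 :=
    hfs.mul_of_nonneg hgs (fun m => mul_nonneg (hf m) (pow_nonneg hs m)) (fun m => mul_nonneg (hg m) (pow_nonneg hs m))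
  have h1 := summable_sum_mul_antidiagonal_of_summable_mul (f := fun m => f m * s ^ m) (g := fun m => g m * s ^ m) hfg
  have h2 := hfs.tsum_mul_tsum_eq_tsum_sum_antidiagonal hgs hfg
  have hterm : ∀ m, ∑ p ∈ antidiagonal m, f p.1 * s ^ p.1 * (g p.2 * s ^ p.2) =
      (∑ p ∈ antidiagonal m, f p.1 * g p.2) * s ^ m := fun m => by
    rw [sum_mul]
    refine sum_congr rfl fun p hp => ?_
    have hp' : p.1 + p.2 = m := HasAntidiagonal.mem_antidiagonal.mp hp
    rw [← hp', pow_add]; ring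
  simp only [hterm] at h1 h2
  exact ⟨h1, h2.symm⟩

/-- ★★ **The renewal equation of the generating functions**: `D_T(s) = I_T(s) + I_T(s) · D_T(s)` for `0 ≤ s < 1` (from the exact
coefficientwise equation `LUM_ren` by Cauchy products). [cite: DuminilCopinHammond2013, §2.2; Feller1968, XIII.3; lane «pcv-sawmu» a-p2 g21] -/
theorem stripLenD_eq_stripLenI_add_mul (hT : 1 ≤ T) (hs0 : 0 ≤ s) (hs1 : s < 1) :
    stripLenD T s = stripLenI T s + stripLenI T s * stripLenD T s := by
  have hy := (stripYT_pos hT).le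
  ext a b
  rw [Matrix.add_apply, Matrix.mul_apply]
  simp only [stripLenD, stripLenI]
  -- each `c`-term is a Cauchy product
  have hc : ∀ c : Fin (2 * T),
      (∑' n : ℕ, LMM T n (n : ℤ) (stripYT T) a c * s ^ n) * (∑' n : ℕ, LUM T n (n : ℤ) (stripYT T) c b * s ^ n) =
        ∑' m : ℕ, (∑ p ∈ antidiagonal m, LMM T p.1 (p.1 : ℤ) (stripYT T) a c * LUM T p.2 (p.2 : ℤ) (stripYT T) c b) * s ^ m ∧
      Summable (fun m : ℕ => (∑ p ∈ antidiagonal m, LMM T p.1 (p.1 : ℤ) (stripYT T) a c * LUM T p.2 (p.2 : ℤ) (stripYT T) c b) * s ^ m) := by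
    intro c
    obtain ⟨h0ac, -, hMac⟩ := lenSlices_basic hT a c hs0 hs1
    obtain ⟨h0cb, hDcb, -⟩ := lenSlices_basic hT c b hs0 hs1
    have h := tsum_antidiagonal_mul_pow' (fun m => (h0ac m).1) (fun m => (h0cb m).2.1) hs0 hMac hDcb
    exact ⟨h.2.symm, h.1⟩
  rw [show (∑ c : Fin (2 * T), (∑' n : ℕ, LMM T n (n : ℤ) (stripYT T) a c * s ^ n) *
      ∑' n : ℕ, LUM T n (n : ℤ) (stripYT T) c b * s ^ n) =
      ∑ c : Fin (2 * T), ∑' m : ℕ, (∑ p ∈ antidiagonal m,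
        LMM T p.1 (p.1 : ℤ) (stripYT T) a c * LUM T p.2 (p.2 : ℤ) (stripYT T) c b) * s ^ m from sum_congr rfl fun c _ => (hc c).1]
  rw [← Summable.tsum_finsetSum (fun c _ => (hc c).2)]
  obtain ⟨-, hD, hM⟩ := lenSlices_basic hT a b hs0 hs1
  rw [← hM.tsum_add (summable_sum fun c _ => (hc c).2)]
  refine tsum_congr fun m => ?_
  rw [LUM_ren hy m, Matrix.add_apply, Matrix.sum_apply, add_mul]
  congr 1
  rw [← sum_mul]
  congr 1
  simp only [Matrix.mul_apply]
  rw [sum_comm]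

end Series

/-! ### §2 The Neumann series of `I_T(s)`: `Σ_{k≥0} I_T(s)^k = 1 + D_T(s)` for `0 ≤ s < 1` -/

section Neumann

variable {s : ℝ}

/-- `I_T(s) ≥ 0` entrywise (plumbing). [cite: DuminilCopinHammond2013, §2.2; lane plumbing] -/
theorem stripLenI_nonneg (hT : 1 ≤ T) (hs0 : 0 ≤ s) (hs1 : s < 1) (a b : Fin (2 * T)) : 0 ≤ stripLenI T s a b :=
  (stripLenI_nonneg_le_stripLenD hT hs0 hs1 a b).1

/-- The partial Neumann sums stay below `1 + D_T(s)`: `Σ_{k<K} (I_T(s)^k)_{ab} ≤ [a=b] + D_T(s)_{ab}` (induction on `K` with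
`I + I·D = D` and non-negativity). [cite: Feller1968, XIII.3; Seneta1973, §6.1; lane plumbing] -/
theorem sum_range_pow_stripLenI_le (hT : 1 ≤ T) (hs0 : 0 ≤ s) (hs1 : s < 1) (K : ℕ) (a b : Fin (2 * T)) :
    ∑ k ∈ range K, (stripLenI T s ^ k) a b ≤ (1 + stripLenD T s) a b := by
  -- matrix form: `Σ_{k<K} I^k ≤ 1 + D` entrywise, by induction
  have hI0 := stripLenI_nonneg hT hs0 hs1 (T := T)
  have hD0 : ∀ a b, 0 ≤ stripLenD T s a b := fun a b => (stripLenI_nonneg_le_stripLenD hT hs0 hs1 a b).2.2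
  have hren := stripLenD_eq_stripLenI_add_mul hT hs0 hs1 (T := T)
  suffices h : ∀ K, ∀ a b, (∑ k ∈ range K, stripLenI T s ^ k) a b ≤ (1 + stripLenD T s) a b by
    have := h K a b
    rwa [Matrix.sum_apply] at this
  intro K
  induction K with
  | zero =>
    intro a b
    simp only [sum_range_zero, Matrix.zero_apply, Matrix.add_apply]
    have h1 : (0 : ℝ) ≤ (1 : Matrix (Fin (2 * T)) (Fin (2 * T)) ℝ) a b := by
      rw [Matrix.one_apply]; split_ifs <;> norm_num
    linarith [hD0 a b]
  | succ K ih =>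
    intro a b
    -- `Σ_{k<K+1} I^k = 1 + I · Σ_{k<K} I^k ≤ 1 + I · (1 + D) = 1 + (I + I D) = 1 + D`
    have hstep : (∑ k ∈ range (K + 1), stripLenI T s ^ k) = 1 + stripLenI T s * ∑ k ∈ range K, stripLenI T s ^ k := by
      rw [Finset.sum_range_succ', pow_zero, add_comm, Finset.mul_sum]
      congr 1
      exact sum_congr rfl fun k _ => by rw [pow_succ']
    rw [hstep, Matrix.add_apply, Matrix.add_apply]
    refine add_le_add le_rfl ?_
    rw [Matrix.mul_apply]
    calc ∑ c, stripLenI T s a c * (∑ k ∈ range K, stripLenI T s ^ k) c b ≤ ∑ c, stripLenI T s a c * (1 + stripLenD T s) c b :=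
          sum_le_sum fun c _ => mul_le_mul_of_nonneg_left (ih c b) (hI0 a c)
      _ = (stripLenI T s * (1 + stripLenD T s)) a b := by rw [Matrix.mul_apply]
      _ = stripLenD T s a b := by rw [Matrix.mul_add, Matrix.mul_one, ← hren]

/-- ★ The Neumann series of `I_T(s)` converges entrywise for `0 ≤ s < 1`. [cite: Seneta1973, §6.1 Theorem 6.1; lane «pcv-sawmu» a-p2 g21] -/
theorem summable_pow_stripLenI (hT : 1 ≤ T) (hs0 : 0 ≤ s) (hs1 : s < 1) (a b : Fin (2 * T)) :
    Summable fun k : ℕ => (stripLenI T s ^ k) a b := by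
  refine summable_of_sum_range_le (fun k => nonnegMat_pow_apply_nonneg (stripLenI_nonneg hT hs0 hs1) k a b) ?_ (c := (1 + stripLenD T s) a b)
  exact fun K => sum_range_pow_stripLenI_le hT hs0 hs1 K a b

/-- ★★ **`Σ_k I_T(s)^k = 1 + D_T(s)`** for `0 ≤ s < 1`: the Neumann series of the irreducible kernel in the length fugacity is the
all-bridges series (`D − Σ_{1≤k≤K} I^k = I^K · D → 0`). [cite: DuminilCopinHammond2013, §2.2 (unique decomposition into irreducible bridges); Seneta1973, §6.1; lane «pcv-sawmu» a-p2 g21 — own] -/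
theorem neumannSum_stripLenI_eq (hT : 1 ≤ T) (hs0 : 0 ≤ s) (hs1 : s < 1) :
    neumannSum (stripLenI T s) = 1 + stripLenD T s := by
  have hI0 := stripLenI_nonneg hT hs0 hs1 (T := T)
  have hsum := summable_pow_stripLenI hT hs0 hs1 (T := T)
  have hren := stripLenD_eq_stripLenI_add_mul hT hs0 hs1 (T := T)
  -- `S = 1 + I S` and `(1 + D) = 1 + I (1 + D)`; the difference `E := (1 + D) − S ≥ 0` satisfies `E = I E = I^K E ≤ ` tail sums → 0
  have hS := neumannSum_eq_one_add_mul hsum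
  ext a b
  refine le_antisymm ?_ ?_
  · -- `S_{ab} ≤ 1 + D` from the partial sums
    have ht := (tendsto_sum_range_pow_apply hsum a b)
    exact le_of_tendsto' ht fun K => by rw [Matrix.sum_apply]; exact sum_range_pow_stripLenI_le hT hs0 hs1 K a b
  · -- `1 + D ≤ S`: `(1 + D) − Σ_{k<K} I^k = I^K (1 + D)`, and `I^K (1+D) ≤ Σ_{k ≥ K} I^k (1+D)`… simpler: `D = Σ_{k=1}^{K} I^k + I^K D`
    -- and `(I^K D)_{ab} ≤ Σ_c (I^K)_{ac} D_{cb}` with `(I^K)_{ac} → 0` (terms of a convergent series)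
    have hD0 : ∀ a b, 0 ≤ stripLenD T s a b := fun a b => (stripLenI_nonneg_le_stripLenD hT hs0 hs1 a b).2.2
    have hiter : ∀ K : ℕ, 1 + stripLenD T s = ∑ k ∈ range K, stripLenI T s ^ k + stripLenI T s ^ K * (1 + stripLenD T s) := by
      intro K
      induction K with
      | zero => simp
      | succ K ih =>
        rw [Finset.sum_range_succ, pow_succ, Matrix.mul_assoc, Matrix.mul_add, Matrix.mul_one, ← hren]
        -- `ih : 1 + D = Σ_{k<K} I^k + I^K (1 + D)`; expand `I^K (1 + D) = I^K + I^K D`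
        rw [Matrix.mul_add, Matrix.mul_one] at ih
        rw [ih]; abel
    have hlim : Tendsto (fun K => ((stripLenI T s ^ K * (1 + stripLenD T s) : Matrix (Fin (2 * T)) (Fin (2 * T)) ℝ)) a b) atTop (𝓝 0) := by
      have h0 : ∀ c, Tendsto (fun K => (stripLenI T s ^ K) a c) atTop (𝓝 0) := fun c => (hsum a c).tendsto_atTop_zero
      have : Tendsto (fun K => ∑ c, (stripLenI T s ^ K) a c * (1 + stripLenD T s) c b) atTop (𝓝 (∑ c : Fin (2 * T), 0 * (1 + stripLenD T s) c b)) :=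
        tendsto_finsetSum _ fun c _ => (h0 c).mul_const _
      simp only [zero_mul, sum_const_zero] at this
      refine this.congr fun K => ?_
      rw [Matrix.mul_apply]
    have ht2 : Tendsto (fun K => (∑ k ∈ range K, stripLenI T s ^ k) a b + ((stripLenI T s ^ K * (1 + stripLenD T s) : Matrix (Fin (2 * T)) (Fin (2 * T)) ℝ)) a b) atTop
        (𝓝 (neumannSum (stripLenI T s) a b + 0)) := by
      refine Tendsto.add ?_ hlim
      have := tendsto_sum_range_pow_apply hsum a b
      refine this.congr fun K => ?_
      rw [Matrix.sum_apply]
    rw [add_zero] at ht2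
    refine ge_of_tendsto' ht2 fun K => ?_
    have := congrFun (congrFun (hiter K) a) b
    rw [Matrix.add_apply] at this
    exact this.le

end Neumann

/-! ### §3 Irreducibility: every power series entry of `I_T(s)` dominates a truncated irreducible kernel at `y = 1` -/

section Irred

/-- `I_N(y)_{ab} = Σ_{σ=1}^{N} LMs T N σ a b y`: an irreducible bridge with at most `N + 1` and at least two vertices has `1 ≤ σ ≤ N` steps
(the equality form of the tree's `sum_LMM_le_Imat`). [cite: DuminilCopinHammond2013, §2.2; lane plumbing] -/
theorem Imat_eq_sum_LMs (N : ℕ) (y : ℝ) (a b : Fin (2 * T)) :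
    Imat T N y a b = ∑ σ ∈ Finset.Icc (1 : ℤ) N, LMs T N σ (a : ℕ) (b : ℕ) y := by
  classical
  simp only [Imat, Dk, LMs, LMset]
  rw [sum_fiberwise_of_maps_to]
  intro l hl
  rw [HBk, mem_filter, mem_hBridgesN_iff] at hl
  obtain ⟨⟨-, -, hlenN, -⟩, h2, -⟩ := hl
  rw [Finset.mem_Icc]
  unfold hlen
  constructor <;> omega

/-- ★ `I_T(s)_{ab} ≥ s^N · I_N(1)_{ab}` for `0 ≤ s`, `N ≥ 1` — the length series dominates the truncated irreducible kernel at `y = 1`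
(`y_T ≥ 1`, `s^n ≥ s^N` for `n ≤ N`, `s ≤ 1`). [cite: DuminilCopinHammond2013, §2.2; lane «pcv-sawmu» a-p2 g21] -/
theorem pow_mul_Imat_one_le_stripLenI (hT : 1 ≤ T) {s : ℝ} (hs0 : 0 ≤ s) (hs1 : s < 1) (N : ℕ) (a b : Fin (2 * T)) :
    s ^ N * Imat T N 1 a b ≤ stripLenI T s a b := by
  classical
  have hyT := one_lt_stripYT hT
  obtain ⟨h0, -, hM⟩ := lenSlices_basic hT a b hs0 hs1
  rw [Imat_eq_sum_LMs, mul_sum]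
  -- `Σ_{σ ∈ [1,N]} s^N LMs T N σ (1) ≤ Σ_{n ∈ [1,N]} LMM T n n y_T s^n ≤ Σ_n …`
  calc ∑ σ ∈ Finset.Icc (1 : ℤ) N, s ^ N * LMs T N σ (a : ℕ) (b : ℕ) 1
      = ∑ n ∈ Finset.Icc 1 N, s ^ N * LMs T N (n : ℤ) (a : ℕ) (b : ℕ) 1 := by
        refine (sum_nbij' (fun n : ℕ => (n : ℤ)) (fun σ : ℤ => σ.toNat) (fun n hn => ?_) (fun σ hσ => ?_) (fun n hn => by simp)
          (fun σ hσ => ?_) (fun n hn => rfl)).symm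
        · rw [Finset.mem_Icc] at hn ⊢; omega
        · rw [Finset.mem_Icc] at hσ ⊢; omega
        · rw [Finset.mem_Icc] at hσ; omega
    _ ≤ ∑ n ∈ Finset.Icc 1 N, LMM T n (n : ℤ) (stripYT T) a b * s ^ n := by
        refine sum_le_sum fun n hn => ?_
        rw [Finset.mem_Icc] at hn
        have h1 : LMs T N (n : ℤ) (a : ℕ) (b : ℕ) 1 ≤ LMs T N (n : ℤ) (a : ℕ) (b : ℕ) (stripYT T) :=
          sum_le_sum fun l _ => wD_mono zero_le_one hyT.le l
        have h2 : LMs T N (n : ℤ) (a : ℕ) (b : ℕ) (stripYT T) = LMM T n (n : ℤ) (stripYT T) a b := by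
          simp only [LMM, LMs]
          rw [LMset_eq_of_le (show (n : ℤ) ≤ N by omega) (le_refl (n : ℤ))]
        have h3 : s ^ N ≤ s ^ n := pow_le_pow_of_le_one hs0 hs1.le (by omega)
        have h4 : 0 ≤ LMs T N (n : ℤ) (a : ℕ) (b : ℕ) 1 := (LUs_LMs_nonneg zero_le_one _ _).2
        calc s ^ N * LMs T N (n : ℤ) (a : ℕ) (b : ℕ) 1 ≤ s ^ n * LMs T N (n : ℤ) (a : ℕ) (b : ℕ) (stripYT T) :=
              mul_le_mul h3 h1 h4 (pow_nonneg hs0 _)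
          _ = LMM T n (n : ℤ) (stripYT T) a b * s ^ n := by rw [h2, mul_comm]
    _ ≤ ∑' n : ℕ, LMM T n (n : ℤ) (stripYT T) a b * s ^ n :=
        hM.sum_le_tsum _ fun n _ => mul_nonneg (h0 n).1 (pow_nonneg hs0 _)
    _ = stripLenI T s a b := rfl

/-- ★★ **`I_T(s)` is irreducible** for `0 < s < 1` (`T ≥ 1`): every pair of levels is joined by a positive entry of some power
(from the tree's irreducibility of the truncated kernel `I_2(1)` and the domination `I_T(s) ≥ s² I_2(1)`).
[cite: DuminilCopinHammond2013, §2.2; Seneta1973, §6.1; lane «pcv-sawmu» a-p2 g21] -/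
theorem stripLenI_irred (hT : 1 ≤ T) {s : ℝ} (hs0 : 0 < s) (hs1 : s < 1) (a b : Fin (2 * T)) : ∃ j : ℕ, 0 < (stripLenI T s ^ j) a b := by
  obtain ⟨j, hj⟩ := reach_Imat_all hT (N := 2) le_rfl a b
  refine ⟨j, lt_of_lt_of_le ?_ (nonnegMat_pow_apply_mono (A := s ^ 2 • Imat T 2 1)
    (fun a b => smul_nonneg (pow_nonneg hs0.le _) (Imat_Dmat_nonneg (k := 1) zero_le_one a b).1)
    (fun a b => by rw [Matrix.smul_apply, smul_eq_mul]; exact pow_mul_Imat_one_le_stripLenI hT hs0.le hs1 2 a b) j a b)⟩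
  rw [smul_pow, Matrix.smul_apply, smul_eq_mul]
  exact mul_pos (pow_pos (pow_pos hs0 _) _) hj

end Irred

/-! ### §4 Monotonicity and convexity in the length fugacity -/

section Convex

/-- The entries of `I_T(s)` are non-decreasing in `s ∈ [0,1)`. [cite: Seneta1973, §6.2 (monotone families); lane plumbing] -/
theorem stripLenI_mono (hT : 1 ≤ T) {s s' : ℝ} (hs : s ∈ Set.Ico (0 : ℝ) 1) (hs' : s' ∈ Set.Ico (0 : ℝ) 1) (hss : s ≤ s')
    (a b : Fin (2 * T)) : stripLenI T s a b ≤ stripLenI T s' a b := by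
  obtain ⟨h0, -, hM⟩ := lenSlices_basic hT a b hs.1 hs.2
  obtain ⟨-, -, hM'⟩ := lenSlices_basic hT a b hs'.1 hs'.2
  exact hM.tsum_le_tsum (fun n => mul_le_mul_of_nonneg_left (pow_le_pow_left₀ hs.1 hss _) (h0 n).1) hM'

/-- The entries of `I_T(s)` are CONVEX in `s` on `[0,1)` (a power series with non-negative coefficients: termwise convexity of
the monomials, summed). [cite: Seneta1973, §6.2 (convexity hypothesis of the R-theory argument); lane plumbing] -/
theorem stripLenI_convexOn (hT : 1 ≤ T) (a b : Fin (2 * T)) : ConvexOn ℝ (Set.Ico (0 : ℝ) 1) fun s => stripLenI T s a b := by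
  refine ⟨convex_Ico 0 1, fun s hs s' hs' θ θ' hθ hθ' hθθ => ?_⟩
  have hmem : θ * s + θ' * s' ∈ Set.Ico (0 : ℝ) 1 := by
    have := (convex_Ico (0 : ℝ) 1) hs hs' hθ hθ' hθθ
    simpa only [smul_eq_mul] using this
  obtain ⟨h0, -, hMs⟩ := lenSlices_basic hT a b hs.1 hs.2
  obtain ⟨-, -, hMs'⟩ := lenSlices_basic hT a b hs'.1 hs'.2
  obtain ⟨-, -, hMm⟩ := lenSlices_basic hT a b hmem.1 hmem.2
  -- each monomial `c_n t^n` (`c_n ≥ 0`) is convex on `[0, ∞)`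
  have hmono : ∀ n : ℕ, LMM T n (n : ℤ) (stripYT T) a b * (θ * s + θ' * s') ^ n ≤
      θ * (LMM T n (n : ℤ) (stripYT T) a b * s ^ n) + θ' * (LMM T n (n : ℤ) (stripYT T) a b * s' ^ n) := by
    intro n
    have hcx := (convexOn_pow n).2 (Set.mem_Ici.2 hs.1) (Set.mem_Ici.2 hs'.1) hθ hθ' hθθ
    simp only [smul_eq_mul] at hcx
    have := mul_le_mul_of_nonneg_left hcx (h0 n).1
    linarith [this]
  have hsum : Summable fun n : ℕ =>
      θ * (LMM T n (n : ℤ) (stripYT T) a b * s ^ n) + θ' * (LMM T n (n : ℤ) (stripYT T) a b * s' ^ n) :=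
    (hMs.mul_left θ).add (hMs'.mul_left θ')
  simp only [stripLenI, smul_eq_mul]
  calc ∑' n : ℕ, LMM T n (n : ℤ) (stripYT T) a b * (θ * s + θ' * s') ^ n
      ≤ ∑' n : ℕ, (θ * (LMM T n (n : ℤ) (stripYT T) a b * s ^ n) + θ' * (LMM T n (n : ℤ) (stripYT T) a b * s' ^ n)) :=
        hMm.tsum_le_tsum hmono hsum
    _ = θ * ∑' n : ℕ, LMM T n (n : ℤ) (stripYT T) a b * s ^ n + θ' * ∑' n : ℕ, LMM T n (n : ℤ) (stripYT T) a b * s' ^ n := by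
        rw [(hMs.mul_left θ).tsum_add (hMs'.mul_left θ'), tsum_mul_left, tsum_mul_left]

end Convex

/-! ### §5 First-order bounds: `c/(1−s) ≤ Σ_k (I_T(s)^k)_{ab} ≤ C/(1−s)` near `s = 1` -/

section Bounds

/-- ★ **Upper bound**: `(Σ_k I_T(s)^k)_{ab} = [a=b] + D_T(s)_{ab} ≤ (1 + K)/(1 − s)` on `[0,1)`, from the length-pointwise bound
`D(n)_{ab} ≤ K`. [cite: DuminilCopinHammond2013, §2.2; Seneta1973, §6.2; lane «pcv-sawmu» a-p2 g21] -/
theorem exists_neumannSum_stripLenI_le (hT : 1 ≤ T) :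
    ∃ C : ℝ, ∀ s ∈ Set.Ico (0 : ℝ) 1, ∀ a b : Fin (2 * T), neumannSum (stripLenI T s) a b ≤ C / (1 - s) := by
  obtain ⟨K, hK⟩ := exists_LUs_stripYT_le hT
  have hK0 : 0 ≤ K := le_trans (LUs_LMs_nonneg (T := T) (N := 0) (σ := 0) (stripYT_pos hT).le 0 0).1 (hK 0 0 ⟨0, by omega⟩ ⟨0, by omega⟩)
  refine ⟨1 + K, fun s hs a b => ?_⟩
  have h1s : 0 < 1 - s := sub_pos.2 hs.2
  rw [neumannSum_stripLenI_eq hT hs.1 hs.2, Matrix.add_apply]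
  obtain ⟨h0, hD, -⟩ := lenSlices_basic hT a b hs.1 hs.2
  have hDle : stripLenD T s a b ≤ K / (1 - s) := by
    have hgeom : HasSum (fun n : ℕ => K * s ^ n) (K / (1 - s)) := by
      rw [div_eq_mul_inv]; exact (hasSum_geometric_of_lt_one hs.1 hs.2).mul_left K
    refine le_trans (hD.tsum_le_tsum (fun n => ?_) hgeom.summable) hgeom.tsum_eq.le
    exact mul_le_mul_of_nonneg_right (by rw [LUM]; exact hK n _ a b) (pow_nonneg hs.1 _)
  have h1 : (1 : Matrix (Fin (2 * T)) (Fin (2 * T)) ℝ) a b ≤ 1 / (1 - s) := by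
    rw [Matrix.one_apply]
    have : (1 : ℝ) ≤ 1 / (1 - s) := by rw [le_div_iff₀ h1s]; linarith [hs.1]
    split_ifs <;> linarith [this]
  calc (1 : Matrix (Fin (2 * T)) (Fin (2 * T)) ℝ) a b + stripLenD T s a b ≤ 1 / (1 - s) + K / (1 - s) := add_le_add h1 hDle
    _ = (1 + K) / (1 - s) := by rw [add_div]

/-- ★ **Lower bound for the total series** (Abel summation): with `partialSum_LUM_linear` (`Σ_{n≤N} Σ_{ab} D(n)_{ab} ≥ cN − C`),
`Σ_{ab} D_T(s)_{ab} ≥ c·s/(1−s) − C` on `[0,1)` (`T ≥ 2`). [cite: DuminilCopinHammond2013, §2.2; Feller1971, XIII.5 (Abel summation); lane «pcv-sawmu» a-p2 g21] -/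
theorem exists_le_sum_stripLenD (hT : 2 ≤ T) :
    ∃ c : ℝ, 0 < c ∧ ∃ C : ℝ, ∀ s ∈ Set.Ico (0 : ℝ) 1,
      c * s / (1 - s) - C ≤ ∑ a : Fin (2 * T), ∑ b : Fin (2 * T), stripLenD T s a b := by
  have hT1 : 1 ≤ T := by omega
  have hy := (stripYT_pos hT1).le
  obtain ⟨c, hc, C, K, hlin⟩ := partialSum_LUM_linear hT
  refine ⟨c, hc, max C 0, fun s hs => ?_⟩
  have h1s : 0 < 1 - s := sub_pos.2 hs.2
  -- the total slices `t n = Σ_{ab} D(n)_{ab}`, `t 0 = 0`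
  set t : ℕ → ℝ := fun n => ∑ a : Fin (2 * T), ∑ b : Fin (2 * T), LUM T n (n : ℤ) (stripYT T) a b with ht
  have ht0 : ∀ n, 0 ≤ t n := fun n => sum_nonneg fun a _ => sum_nonneg fun b _ => (LMM_LUM_nonneg hy _ a b).2
  have htz : t 0 = 0 := by
    simp only [ht]
    exact sum_eq_zero fun a _ => sum_eq_zero fun b _ => by rw [Nat.cast_zero]; exact LUM_eq_zero_of_le le_rfl _ a b
  have hts : Summable fun n => t n * s ^ n := by
    simp only [ht, sum_mul]
    exact summable_sum fun a _ => summable_sum fun b _ => (lenSlices_basic hT1 a b hs.1 hs.2).2.1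
  have hF : ∑ a : Fin (2 * T), ∑ b : Fin (2 * T), stripLenD T s a b = ∑' n, t n * s ^ n := by
    simp only [stripLenD, ht, sum_mul]
    rw [Summable.tsum_finsetSum (fun a _ => summable_sum fun b _ => (lenSlices_basic hT1 a b hs.1 hs.2).2.1)]
    refine sum_congr rfl fun a _ => ?_
    rw [Summable.tsum_finsetSum (fun b _ => (lenSlices_basic hT1 a b hs.1 hs.2).2.1)]
  -- Abel summation: `(Σ s^n) · (Σ t_n s^n) = Σ_m P_m s^m` with `P_m = Σ_{n ≤ m} t_n ≥ c m − C`
  have hgeom : Summable fun n : ℕ => (1 : ℝ) * s ^ n := by simpa using summable_geometric_of_lt_one hs.1 hs.2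
  obtain ⟨hPs, hP⟩ := tsum_antidiagonal_mul_pow' (f := fun _ => (1 : ℝ)) (g := t) (fun _ => zero_le_one) ht0 hs.1 hgeom hts
  have hPm : ∀ m, ∑ p ∈ antidiagonal m, (1 : ℝ) * t p.2 = ∑ n ∈ Finset.Icc 1 m, t n := by
    intro m
    rw [← Finset.Nat.sum_antidiagonal_swap]
    simp only [Prod.snd_swap, one_mul]
    rw [Finset.Nat.sum_antidiagonal_eq_sum_range_succ_mk, Finset.range_eq_Ico, Finset.sum_eq_sum_Ico_succ_bot (by omega), htz, zero_add]
    rfl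
  have hPge : ∀ m : ℕ, c * m - max C 0 ≤ ∑ p ∈ antidiagonal m, (1 : ℝ) * t p.2 := fun m => by
    rw [hPm]; linarith [(hlin m).1, le_max_left C 0]
  -- `Σ_m (c m − C') s^m = c s/(1−s)² − C'/(1−s)`
  have hs_norm : ‖s‖ < 1 := by rw [Real.norm_of_nonneg hs.1]; exact hs.2
  have hm : HasSum (fun m : ℕ => (m : ℝ) * s ^ m) (s / (1 - s) ^ 2) := by
    have := tsum_coe_mul_geometric_of_norm_lt_one hs_norm
    rw [← this]
    exact (summable_pow_mul_geometric_of_norm_lt_one 1 hs_norm |>.congr fun m => by simp [pow_one]).hasSum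
  have hg1 : HasSum (fun m : ℕ => s ^ m) (1 - s)⁻¹ := hasSum_geometric_of_lt_one hs.1 hs.2
  have hlow : HasSum (fun m : ℕ => (c * m - max C 0) * s ^ m) (c * (s / (1 - s) ^ 2) - max C 0 * (1 - s)⁻¹) := by
    have := (hm.mul_left c).sub (hg1.mul_left (max C 0))
    refine this.congr_fun fun m => ?_
    ring
  have hcmp : c * (s / (1 - s) ^ 2) - max C 0 * (1 - s)⁻¹ ≤ ∑' m, (∑ p ∈ antidiagonal m, (1 : ℝ) * t p.2) * s ^ m := by
    rw [← hlow.tsum_eq]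
    exact hlow.summable.tsum_le_tsum (fun m => mul_le_mul_of_nonneg_right (hPge m) (pow_nonneg hs.1 _)) hPs
  -- `(Σ s^n)(Σ t s^n) = (1−s)⁻¹ F(s)`
  rw [hP, show (∑' m : ℕ, (1 : ℝ) * s ^ m) = (1 - s)⁻¹ by simpa using hg1.tsum_eq] at hcmp
  rw [hF]
  -- divide by `(1 − s)⁻¹ > 0`
  have hinv : 0 < (1 - s)⁻¹ := inv_pos.2 h1s
  have key : c * s / (1 - s) - max C 0 = (c * (s / (1 - s) ^ 2) - max C 0 * (1 - s)⁻¹) / (1 - s)⁻¹ := by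
    field_simp
  rw [key, div_le_iff₀ hinv]
  linarith [hcmp]

end Bounds

/-! ### §6 ★★★ The residue of the bridge kernel in the LENGTH fugacity: `(1 − s) · D_T(s)_{ab} → ρ′ u′_a ℓ′_b` -/

section Residue

/-- ★★ **`s ↦ I_T(s)` is a `NeumannFamily` on a left neighbourhood `[s₁, 1)` of `1`** (`T ≥ 2`): non-negative, non-decreasing, convex,
irreducible at `s₁`, summable Neumann series `= 1 + D_T(s)`, and the two-sided first-order bounds `c/(1−s) ≤ Σ_k (I_T(s)^k)_{ab} ≤ C/(1−s)`
for every entry (upper: length-pointwise law; lower: the linear law in length by Abel summation, spread to the entries by irreducibility).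
[cite: Seneta1973, Chapter 6 (R-theory); DuminilCopinHammond2013, §2.2; lane «pcv-sawmu» a-p2 g21 — own] -/
theorem exists_neumannFamily_stripLenI (hT : 2 ≤ T) :
    ∃ s₁ ∈ Set.Ico (0 : ℝ) 1, ∃ c C : ℝ, NeumannFamily (fun s => stripLenI T s) s₁ 1 c C := by
  classical
  have hT1 : 1 ≤ T := by omega
  haveI : Nonempty (Fin (2 * T)) := ⟨⟨0, by omega⟩⟩
  obtain ⟨Cup, hCup⟩ := exists_neumannSum_stripLenI_le hT1
  obtain ⟨c₀, hc₀, C₀, hlow⟩ := exists_le_sum_stripLenD hT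
  -- irreducibility at `s₀ = 1/2`, spreading constant `p`
  have hs₀ : (1 / 2 : ℝ) ∈ Set.Ico (0 : ℝ) 1 := ⟨by norm_num, by norm_num⟩
  obtain ⟨p, hp, hspread⟩ := exists_pos_mul_neumannSum_le (stripLenI_nonneg hT1 hs₀.1 hs₀.2) (stripLenI_irred hT1 (by norm_num) (by norm_num))
  -- choose `s₁ ∈ [1/2, 1)` with `c₀ s − C₀ (1 − s) ≥ c₀/4` on `[s₁, 1)`
  obtain ⟨s₁, hs₁, hs₁low⟩ : ∃ s₁ ∈ Set.Ico (1 / 2 : ℝ) 1, ∀ s ∈ Set.Ico s₁ 1, c₀ / 4 ≤ c₀ * s - max C₀ 0 * (1 - s) := by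
    refine ⟨max (1 / 2) (1 - c₀ / (4 * (c₀ + max C₀ 0))), ⟨le_max_left _ _, max_lt (by norm_num) ?_⟩, fun s hs => ?_⟩
    · have : 0 < c₀ / (4 * (c₀ + max C₀ 0)) := by positivity
      linarith
    · have h1 : 1 - c₀ / (4 * (c₀ + max C₀ 0)) ≤ s := (le_max_right _ _).trans hs.1
      have hden : 0 < 4 * (c₀ + max C₀ 0) := by positivity
      have h2 : (1 - s) * (4 * (c₀ + max C₀ 0)) ≤ c₀ := by
        have : 1 - s ≤ c₀ / (4 * (c₀ + max C₀ 0)) := by linarith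
        calc (1 - s) * (4 * (c₀ + max C₀ 0)) ≤ c₀ / (4 * (c₀ + max C₀ 0)) * (4 * (c₀ + max C₀ 0)) :=
              mul_le_mul_of_nonneg_right this hden.le
          _ = c₀ := div_mul_cancel₀ _ hden.ne'
      nlinarith [le_max_right C₀ 0, hs.2, hc₀]
  have hs₁I : s₁ ∈ Set.Ico (0 : ℝ) 1 := ⟨by linarith [hs₁.1], hs₁.2⟩
  set F : ℝ := (Fintype.card (Fin (2 * T) × Fin (2 * T)) : ℝ) with hF
  have hF0 : 0 < F := by rw [hF]; exact_mod_cast Fintype.card_pos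
  refine ⟨s₁, hs₁I, p * (c₀ / 4) / F, Cup, ?_⟩
  have hsub : ∀ {s : ℝ}, s ∈ Set.Ico s₁ 1 → s ∈ Set.Ico (0 : ℝ) 1 := fun hs => ⟨hs₁I.1.trans hs.1, hs.2⟩
  exact
    { lt := hs₁.2
      pos := by positivity
      nonneg := fun s hs a b => stripLenI_nonneg hT1 (hsub hs).1 (hsub hs).2 a b
      mono := fun s s' hs hs' hss a b => stripLenI_mono hT1 (hsub hs) (hsub hs') hss a b
      convex := fun a b => (stripLenI_convexOn hT1 a b).subset (Set.Ico_subset_Ico hs₁I.1 le_rfl) (convex_Ico _ _)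
      irred := fun a b => by
        obtain ⟨j, hj⟩ := stripLenI_irred hT1 (by norm_num : (0 : ℝ) < 1 / 2) (by norm_num) a b
        exact ⟨j, lt_of_lt_of_le hj (nonnegMat_pow_apply_mono (stripLenI_nonneg hT1 hs₀.1 hs₀.2)
          (fun a b => stripLenI_mono hT1 hs₀ hs₁I hs₁.1 a b) j a b)⟩
      summable := fun s hs a b => summable_pow_stripLenI hT1 (hsub hs).1 (hsub hs).2 a b
      lower := fun s hs a b => by
        have hsI := hsub hs
        have hpos : 0 < 1 - s := sub_pos.2 hs.2
        -- spread the total lower bound to the entry `(a, b)`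
        have hsp := hspread (stripLenI T s) (fun a b => stripLenI_mono hT1 hs₀ hsI (hs₁.1.trans hs.1) a b)
          (fun a b => summable_pow_stripLenI hT1 hsI.1 hsI.2 a b)
        have h1 : p * ∑ cd : Fin (2 * T) × Fin (2 * T), neumannSum (stripLenI T s) cd.1 cd.2 ≤ F * neumannSum (stripLenI T s) a b := by
          rw [Finset.mul_sum]
          calc ∑ cd : Fin (2 * T) × Fin (2 * T), p * neumannSum (stripLenI T s) cd.1 cd.2
              ≤ ∑ _cd : Fin (2 * T) × Fin (2 * T), neumannSum (stripLenI T s) a b := sum_le_sum fun cd _ => hsp cd.1 cd.2 a b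
            _ = F * neumannSum (stripLenI T s) a b := by rw [sum_const, nsmul_eq_mul, hF, Finset.card_univ]
        -- the total Neumann sum dominates the total `D`-series
        have h2 : ∑ a : Fin (2 * T), ∑ b : Fin (2 * T), stripLenD T s a b ≤
            ∑ cd : Fin (2 * T) × Fin (2 * T), neumannSum (stripLenI T s) cd.1 cd.2 := by
          rw [← Finset.sum_product']
          refine sum_le_sum fun cd _ => ?_
          rw [neumannSum_stripLenI_eq hT1 hsI.1 hsI.2, Matrix.add_apply, Matrix.one_apply]
          split_ifs <;> linarith
        have h3 := hlow s hsI
        have h4 := hs₁low s hs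
        -- `c₀ s/(1−s) − C₀ ≥ (c₀/4)/(1−s)` on `[s₁,1)`
        have h5 : c₀ / 4 / (1 - s) ≤ c₀ * s / (1 - s) - C₀ := by
          rw [div_le_iff₀ hpos, sub_mul, div_mul_cancel₀ _ hpos.ne']
          nlinarith [le_max_left C₀ 0, hpos]
        rw [div_div, div_le_iff₀ (mul_pos hF0 hpos)]
        have h6 : c₀ / 4 / (1 - s) * (1 - s) = c₀ / 4 := div_mul_cancel₀ _ hpos.ne'
        have h7 : p * (c₀ / 4 / (1 - s)) ≤ F * neumannSum (stripLenI T s) a b := by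
          have := mul_le_mul_of_nonneg_left ((h5.trans h3).trans h2) hp.le
          exact this.trans h1
        have := mul_le_mul_of_nonneg_right h7 hpos.le
        calc p * (c₀ / 4) = p * (c₀ / 4 / (1 - s)) * (1 - s) := by rw [mul_assoc, h6]
          _ ≤ F * neumannSum (stripLenI T s) a b * (1 - s) := this
          _ = neumannSum (stripLenI T s) a b * (F * (1 - s)) := by ring
      upper := fun s hs a b => hCup s (hsub hs) a b }

/-- ★★★ **THE RESIDUE OF THE CRITICAL BRIDGE KERNEL IN THE LENGTH FUGACITY** (`T ≥ 2`): there are positive level vectors `u′`, `ℓ′`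
and `ρ′ > 0` such that for ALL levels `a, b`:
`(1 − s) · D_T(s)_{ab} ⟶ ρ′ · u′_a ℓ′_b` as `s ↑ 1`,
where `D_T(s)_{ab} = Σ_n D(n)_{ab} s^n` sums the standard horizontal bridges of `S_T` from level `a` to level `b` with weight
`x_c^n y_T^{#top} s^n` (`n` = number of steps) — equivalently, in the length fugacity `x = s·x_c ↑ x_c` at the surface threshold `y_T`
the bridge generating functions have a first-order singularity with a RANK-ONE residue.  The `x`-direction twin of the tree's
`exists_tendsto_hKernel_residue` (there `y ↑ y_T` at `x = x_c`). [cite: Seneta1973, Chapter 6 (R-theory: §6.1 Theorem 6.1, §6.2 Theorem 6.3); DuminilCopinHammond2013, §2.2; BeatonBousquetMelouDeGierDuminilCopinGuttmann2014, Corollary 8 (arXiv v5 p. 12: ρ_T(y_T) = x_c); lane «pcv-sawmu» a-p2 g21 — own result] -/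
theorem exists_tendsto_stripLenD_residue (hT : 2 ≤ T) :
    ∃ (u ℓ : Fin (2 * T) → ℝ) (ρ : ℝ), (∀ a, 0 < u a) ∧ (∀ b, 0 < ℓ b) ∧ 0 < ρ ∧
      ∀ a b, Tendsto (fun s => (1 - s) * stripLenD T s a b) (𝓝[<] 1) (𝓝 (ρ * (u a * ℓ b))) := by
  have hT1 : 1 ≤ T := by omega
  haveI : Nonempty (Fin (2 * T)) := ⟨⟨0, by omega⟩⟩
  obtain ⟨s₁, hs₁, c, C, hF⟩ := exists_neumannFamily_stripLenI hT
  obtain ⟨u, ℓ, hu0, hℓ0, -, -, hpos, hlim⟩ := hF.exists_tendsto_mul_neumannSum_apply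
  refine ⟨u, ℓ, (ℓ ⬝ᵥ (hF.J *ᵥ u))⁻¹, hu0, hℓ0, inv_pos.2 hpos, fun a b => ?_⟩
  -- `S = 1 + D`, and `(1 − s)·[a = b] → 0`
  have hev : ∀ᶠ s in 𝓝[<] (1 : ℝ), (1 - s) * neumannSum (stripLenI T s) a b - (1 - s) * (1 : Matrix (Fin (2 * T)) (Fin (2 * T)) ℝ) a b
      = (1 - s) * stripLenD T s a b := by
    filter_upwards [Ico_mem_nhdsLT hs₁.2] with s hs
    rw [neumannSum_stripLenI_eq hT1 (hs₁.1.trans hs.1) hs.2, Matrix.add_apply]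
    ring
  refine Tendsto.congr' hev ?_
  have h0 : Tendsto (fun s : ℝ => (1 - s) * (1 : Matrix (Fin (2 * T)) (Fin (2 * T)) ℝ) a b) (𝓝[<] 1) (𝓝 0) := by
    have : Tendsto (fun s : ℝ => (1 - s) * (1 : Matrix (Fin (2 * T)) (Fin (2 * T)) ℝ) a b) (𝓝 1)
        (𝓝 ((1 - 1) * (1 : Matrix (Fin (2 * T)) (Fin (2 * T)) ℝ) a b)) := (tendsto_const_nhds.sub tendsto_id).mul_const _
    rw [sub_self, zero_mul] at this
    exact this.mono_left nhdsWithin_le_nhds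
  have h1 := (hlim a b).sub h0
  rw [sub_zero] at h1
  rw [show (ℓ ⬝ᵥ (hF.J *ᵥ u))⁻¹ * (u a * ℓ b) = u a * ℓ b / (ℓ ⬝ᵥ (hF.J *ᵥ u)) by rw [div_eq_mul_inv, mul_comm]]
  exact h1

end Residue

/-! ### §7 ★★★ The exact Cesàro law of the critical bridges counted by LENGTH -/

section Cesaro

/-- ★★★ **THE EXACT CESÀRO LAW IN LENGTH** (`T ≥ 2`): with the `u′`, `ℓ′`, `ρ′` of `exists_tendsto_stripLenD_residue`, for all levels `a, b`:
`(1/N) · Σ_{n<N} D(n)_{ab} ⟶ ρ′ · u′_a ℓ′_b` as `N → ∞`, where `D(n)_{ab} = LUM T n n y_T a b` is the weight `x_c^n y_T^{#top}` of the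
standard horizontal bridges `a → b` of the strip with exactly `n` steps.  The lane's two-sided law `Σ_{n≤N} Σ_{ab} D(n) ≍ N`
(«BRIDGE-LENGTH-LINEAR») becomes an EXACT first-order asymptotic, entry by entry, with a rank-one constant (Hardy–Littlewood's
Tauberian theorem, index `1`, on the residue).  NOT claimed: the pointwise limit of `D(n)_{ab}` (lengths between fixed levels have
fixed parity: period two). [cite: Feller1971, XIII.5 Theorem 5 (Hardy–Littlewood–Karamata); Seneta1973, Chapter 6; DuminilCopinHammond2013, §2.2; BeatonBousquetMelouDeGierDuminilCopinGuttmann2014, Corollary 8; lane «pcv-sawmu» a-p2 g21 — own result] -/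
theorem exists_tendsto_cesaro_LUM (hT : 2 ≤ T) :
    ∃ (u ℓ : Fin (2 * T) → ℝ) (ρ : ℝ), (∀ a, 0 < u a) ∧ (∀ b, 0 < ℓ b) ∧ 0 < ρ ∧
      ∀ a b, Tendsto (fun N : ℕ => (∑ n ∈ range N, LUM T n (n : ℤ) (stripYT T) a b) / (N : ℝ)) atTop
        (𝓝 (ρ * (u a * ℓ b))) := by
  have hT1 : 1 ≤ T := by omega
  obtain ⟨u, ℓ, ρ, hu, hℓ, hρ, hres⟩ := exists_tendsto_stripLenD_residue hT
  refine ⟨u, ℓ, ρ, hu, hℓ, hρ, fun a b => ?_⟩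
  have hq : ∀ n : ℕ, 0 ≤ LUM T n (n : ℤ) (stripYT T) a b := fun n => (LMM_LUM_nonneg (stripYT_pos hT1).le _ a b).2
  have hC : 0 < ρ * (u a * ℓ b) := mul_pos hρ (mul_pos (hu a) (hℓ b))
  have hHL := (Literature.Analysis.Asymptotics.hardyLittlewood_powerSeries_iff hq zero_le_one hC).mp ⟨fun s hs0 hs1 =>
    (lenSlices_basic hT1 a b hs0 hs1).2.1, ?_⟩
  · have h2 : Real.Gamma (1 + 1) = 1 := by norm_num [Real.Gamma_two]
    rw [h2, div_one] at hHL
    refine hHL.congr fun N => ?_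
    rw [Real.rpow_one]
  · refine (hres a b).congr fun s => ?_
    rw [Real.rpow_one]; rfl

end Cesaro

/-! ### §8 ★★★ Finite mean LENGTH of the critical irreducible bridges -/

section Mean

/-- ★★★ **THE CRITICAL IRREDUCIBLE BRIDGES HAVE FINITE MEAN LENGTH AT THE THRESHOLD** (`T ≥ 2`): for all levels `a, b`,
`Σ_n n · M(n)_{ab} < ∞`, where `M(n)_{ab} = LMM T n n y_T a b` is the `x_c^n y_T^{#top}`-weight of the irreducible standard horizontal
bridges `a → b` of `S_T` with exactly `n` steps — the `mean` field of `RenewalKernelPair.Critical` for the length pair.  From the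
R-theory of `NeumannFamily`: the family `s ↦ I_T(s)` is Lipschitz AT `s = 1` (`Ilim − I_T(s) ≤ (C/c²)(1 − s)`), and
`(I_T(1⁻) − I_T(s))/(1 − s) ≥ Σ_{n<N} M(n)(1 + s + ⋯ + s^{n−1}) → Σ_{n<N} n M(n)`.  (With «BRIDGE-LENGTH-RENEWAL», §6 and the tree's
`Renewal` files, the only input still missing for a pointwise law in length is the period-two bookkeeping.)
[cite: Seneta1973, §6.2 Theorem 6.3 (finiteness at the convergence parameter); DuminilCopinHammond2013, §2.2; Kesten1963SAW, §4 (irreducible-bridge renewal structure — the template); MadrasSlade1993, §4.2 p. 95 (on ℤ^d the mean renewal time is believed infinite — finiteness here is special to the strip); lane «pcv-sawmu» a-p2 g21 — own result] -/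
theorem summable_length_mul_LMM (hT : 2 ≤ T) (a b : Fin (2 * T)) :
    Summable fun n : ℕ => (n : ℝ) * LMM T n (n : ℤ) (stripYT T) a b := by
  have hT1 : 1 ≤ T := by omega
  haveI : Nonempty (Fin (2 * T)) := ⟨⟨0, by omega⟩⟩
  have hy := (stripYT_pos hT1).le
  obtain ⟨s₁, hs₁, c, C, hF⟩ := exists_neumannFamily_stripLenI hT
  set M : ℕ → ℝ := fun n => LMM T n (n : ℤ) (stripYT T) a b with hM
  have hM0 : ∀ n, 0 ≤ M n := fun n => (LMM_LUM_nonneg hy _ a b).1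
  set K : ℝ := C / c ^ 2 with hK
  -- (1) the partial sums of `M` stay below `Ilim`: `Σ_{n<N} M(n) ≤ Ilim`
  have hIlim : ∀ N, ∑ n ∈ range N, M n ≤ hF.Ilim a b := by
    intro N
    -- `Σ_{n<N} M(n) s^n ≤ I_T(s) ≤ Ilim` for `s ∈ [s₁,1)`, and the left side is continuous at `s = 1`
    have hcont : Tendsto (fun s : ℝ => ∑ n ∈ range N, M n * s ^ n) (𝓝[<] 1) (𝓝 (∑ n ∈ range N, M n * 1 ^ n)) :=
      ((continuous_finsetSum _ fun n _ => continuous_const.mul (continuous_pow n)).tendsto 1).mono_left nhdsWithin_le_nhds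
    simp only [one_pow, mul_one] at hcont
    refine le_of_tendsto hcont ?_
    filter_upwards [Ico_mem_nhdsLT hs₁.2] with s hs
    have hsI : s ∈ Set.Ico (0 : ℝ) 1 := ⟨hs₁.1.trans hs.1, hs.2⟩
    obtain ⟨-, -, hMs⟩ := lenSlices_basic hT1 a b hsI.1 hsI.2
    exact (hMs.sum_le_tsum _ fun n _ => mul_nonneg (hM0 n) (pow_nonneg hsI.1 _)).trans (hF.apply_le_Ilim hs a b)
  have hsumM : Summable M := summable_of_sum_range_le hM0 hIlim
  -- (2) for `s ∈ [s₁, 1)`: `Σ_{n<N} M(n) (Σ_{k<n} s^k) ≤ K`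
  have hpoly : ∀ N, ∀ s ∈ Set.Ico s₁ 1, ∑ n ∈ range N, M n * ∑ k ∈ range n, s ^ k ≤ K := by
    intro N s hs
    have hsI : s ∈ Set.Ico (0 : ℝ) 1 := ⟨hs₁.1.trans hs.1, hs.2⟩
    have h1s : 0 < 1 - s := sub_pos.2 hs.2
    obtain ⟨-, -, hMs⟩ := lenSlices_basic hT1 a b hsI.1 hsI.2
    -- `Σ_{n<N} M(n)(1 − s^n) ≤ Ilim − I_T(s) ≤ K (1 − s)`
    have hsplit : ∑ n ∈ range N, M n * (1 - s ^ n) ≤ hF.Ilim a b - stripLenI T s a b := by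
      have hI : stripLenI T s a b = ∑' n, M n * s ^ n := rfl
      have htailM : ∑ n ∈ range N, M n ≤ ∑' n, M n := hsumM.sum_le_tsum _ fun n _ => hM0 n
      have hsum_le : ∑' n, M n ≤ hF.Ilim a b :=
        le_of_tendsto' hsumM.hasSum.tendsto_sum_nat hIlim
      -- `I_T(s) ≤ Σ_{n<N} M(n) s^n + Σ_{n ≥ N} M(n)`
      have hIs : stripLenI T s a b ≤ ∑ n ∈ range N, M n * s ^ n + (∑' n, M n - ∑ n ∈ range N, M n) := by
        rw [hI, ← Summable.sum_add_tsum_nat_add N hMs, ← Summable.sum_add_tsum_nat_add N hsumM]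
        have : ∑' n, M (n + N) * s ^ (n + N) ≤ ∑' n, M (n + N) :=
          ((summable_nat_add_iff N).2 hMs).tsum_le_tsum (fun n => mul_le_of_le_one_right (hM0 _) (pow_le_one₀ hsI.1 hsI.2.le))
            ((summable_nat_add_iff N).2 hsumM)
        linarith
      have hre : ∑ n ∈ range N, M n * (1 - s ^ n) = ∑ n ∈ range N, M n - ∑ n ∈ range N, M n * s ^ n := by
        rw [← sum_sub_distrib]; exact sum_congr rfl fun n _ => by ring
      rw [hre]
      linarith
    have hlip := hF.Ilim_sub_le hs a b
    have hsum_eq : ∑ n ∈ range N, M n * ∑ k ∈ range n, s ^ k = (∑ n ∈ range N, M n * (1 - s ^ n)) / (1 - s) := by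
      rw [sum_div]
      refine sum_congr rfl fun n _ => ?_
      rw [geom_sum_eq hs.2.ne, show s ^ n - 1 = -(1 - s ^ n) by ring, show s - 1 = -(1 - s) by ring, neg_div_neg_eq,
        mul_div_assoc]
    rw [hsum_eq, div_le_iff₀ h1s]
    calc ∑ n ∈ range N, M n * (1 - s ^ n) ≤ hF.Ilim a b - stripLenI T s a b := hsplit
      _ ≤ C / c ^ 2 * (1 - s) := hlip
      _ = K * (1 - s) := by rw [hK]
  -- (3) let `s ↑ 1`: `Σ_{k<n} s^k → n`
  have hmean : ∀ N, ∑ n ∈ range N, (n : ℝ) * M n ≤ K := by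
    intro N
    have hcont : Tendsto (fun s : ℝ => ∑ n ∈ range N, M n * ∑ k ∈ range n, s ^ k) (𝓝[<] 1)
        (𝓝 (∑ n ∈ range N, M n * ∑ k ∈ range n, (1 : ℝ) ^ k)) :=
      ((continuous_finsetSum _ fun n _ => continuous_const.mul
        (continuous_finsetSum _ fun k _ => continuous_pow k)).tendsto 1).mono_left nhdsWithin_le_nhds
    simp only [one_pow, sum_const, card_range, nsmul_eq_mul, mul_one] at hcont
    have h := le_of_tendsto hcont (by filter_upwards [Ico_mem_nhdsLT hs₁.2] with s hs; exact hpoly N s hs)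
    calc ∑ n ∈ range N, (n : ℝ) * M n = ∑ n ∈ range N, M n * (n : ℝ) := sum_congr rfl fun n _ => mul_comm _ _
      _ ≤ K := h
  exact summable_of_sum_range_le (fun n => mul_nonneg (Nat.cast_nonneg _) (hM0 n)) hmean

end Mean

/-! ### §9 The irreducible kernel is FINITE AT the threshold: `Σ_n M(n)_{ab} < ∞` at `y = y_T`, and `I_N(y_T) ↑ Σ_n M(n)` -/

section Threshold

/-- ★★ **The irreducible bridge kernel is entrywise FINITE AT the threshold** (`T ≥ 2`): `Σ_n M(n)_{ab} < ∞` at `y = y_T` — the matrix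
`I_T(x_c; y_T)` of ALL irreducible bridges at the convergence parameter is finite (whereas `Σ_n D(n)_{ab} = +∞` there); from the
R-theory bound `I_T(s) ≤ Ilim` of the `NeumannFamily` and `Σ_{n<N} M(n) s^n → Σ_{n<N} M(n)` as `s ↑ 1`.
[cite: Seneta1973, §6.2 Theorem 6.3 (finiteness at the convergence parameter); DuminilCopinHammond2013, §2.2; lane «pcv-sawmu» a-p2 g21 — own] -/
theorem summable_LMM_stripYT (hT : 2 ≤ T) (a b : Fin (2 * T)) : Summable fun n : ℕ => LMM T n (n : ℤ) (stripYT T) a b := by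
  have hT1 : 1 ≤ T := by omega
  haveI : Nonempty (Fin (2 * T)) := ⟨⟨0, by omega⟩⟩
  have hy := (stripYT_pos hT1).le
  obtain ⟨s₁, hs₁, c, C, hF⟩ := exists_neumannFamily_stripLenI hT
  have hM0 : ∀ n, 0 ≤ LMM T n (n : ℤ) (stripYT T) a b := fun n => (LMM_LUM_nonneg hy _ a b).1
  refine summable_of_sum_range_le hM0 (c := hF.Ilim a b) fun N => ?_
  have hcont : Tendsto (fun s : ℝ => ∑ n ∈ range N, LMM T n (n : ℤ) (stripYT T) a b * s ^ n) (𝓝[<] 1)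
      (𝓝 (∑ n ∈ range N, LMM T n (n : ℤ) (stripYT T) a b * 1 ^ n)) :=
    ((continuous_finsetSum _ fun n _ => continuous_const.mul (continuous_pow n)).tendsto 1).mono_left nhdsWithin_le_nhds
  simp only [one_pow, mul_one] at hcont
  refine le_of_tendsto hcont ?_
  filter_upwards [Ico_mem_nhdsLT hs₁.2] with s hs
  have hsI : s ∈ Set.Ico (0 : ℝ) 1 := ⟨hs₁.1.trans hs.1, hs.2⟩
  obtain ⟨-, -, hMs⟩ := lenSlices_basic hT1 a b hsI.1 hsI.2
  exact (hMs.sum_le_tsum _ fun n _ => mul_nonneg (hM0 n) (pow_nonneg hsI.1 _)).trans (hF.apply_le_Ilim hs a b)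

/-- `I_N(y)_{ab} = Σ_{n ≤ N} M(n)_{ab}` (the truncated irreducible kernel is the partial sum of the length slices; truncation independence).
[cite: DuminilCopinHammond2013, §2.2; lane plumbing] -/
theorem Imat_eq_sum_range_LMM (N : ℕ) (y : ℝ) (a b : Fin (2 * T)) :
    Imat T N y a b = ∑ n ∈ range (N + 1), LMM T n (n : ℤ) y a b := by
  rw [Imat_eq_sum_LMs, Finset.sum_range_succ', Nat.cast_zero, LMM_eq_zero_of_le le_rfl y a b, add_zero]
  refine sum_nbij' (fun σ : ℤ => (σ - 1).toNat) (fun n : ℕ => (n : ℤ) + 1) (fun σ hσ => ?_) (fun n hn => ?_) (fun σ hσ => ?_)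
    (fun n _ => ?_) (fun σ hσ => ?_)
  · rw [Finset.mem_Icc] at hσ; rw [Finset.mem_range]; omega
  · rw [Finset.mem_range] at hn; rw [Finset.mem_Icc]; omega
  · rw [Finset.mem_Icc] at hσ; omega
  · simp only [add_sub_cancel_right, Int.toNat_natCast]
  · rw [Finset.mem_Icc] at hσ
    have hσ' : (((σ - 1).toNat + 1 : ℕ) : ℤ) = σ := by push_cast; omega
    rw [show LMs T N σ (a : ℕ) (b : ℕ) y = LMM T N σ y a b from rfl, hσ']
    have h := (LUM_LMM_eq_of_le (T := T) hσ.2 (show σ ≤ (((σ - 1).toNat + 1 : ℕ) : ℤ) by omega) y).2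
    rw [h]

/-- ★ `I_N(y_T)_{ab} ↑ Σ_n M(n)_{ab}` as `N → ∞` (`T ≥ 2`): the truncated irreducible kernels converge AT the threshold to the finite
full kernel. [cite: Seneta1973, §6.2; DuminilCopinHammond2013, §2.2; lane «pcv-sawmu» a-p2 g21 — own] -/
theorem tendsto_Imat_stripYT (hT : 2 ≤ T) (a b : Fin (2 * T)) :
    Tendsto (fun N : ℕ => Imat T N (stripYT T) a b) atTop (𝓝 (∑' n : ℕ, LMM T n (n : ℤ) (stripYT T) a b)) := by
  have h := ((summable_LMM_stripYT hT a b).hasSum.tendsto_sum_nat).comp (tendsto_add_atTop_nat 1)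
  refine h.congr fun N => ?_
  simp only [Function.comp, Imat_eq_sum_range_LMM]

end Threshold

end HV

end Literature.Probability.RandomPlanarGeometry.SAW
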